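import Summits.RiemannHypothesis.RiemannHypothesis.Theorems.HandoffFlatLobe
import Summits.RiemannHypothesis.RiemannHypothesis.Theorems.HandoffEdgeAsymptoticParam
import HarnessLib

/-!
# HANDOFF, edge block: the SHARP classification — `EdgeNonnegOdd(q)` at large `q` is `q⁺ − q ≤ (1 ± ε)·√q·log q` (rh-explicit, track «HANDOFF», seat prove-2 gen3, ATTEMPT-9)

HONEST FRAMING. Nothing here bears on the truth of RH; the edge block is implied by `H(q)` (theory-1 §I) and everything
below is prime-gap book-keeping. ATTEMPT-8 proved the sufficient side with every constant `c < 1`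
(`edgeNonneg_of_gap_le_of_exp_le`); gen2's necessary side `gap_le_of_edgeNonnegOdd` carried the symbolic constant
`cramerGapConst` of Mathlib's bump. With the flat lobes of `HandoffFlatLobe.lean` (mass ratio `→ 1`, energy ceiling with
the exact leading coefficient) the necessary constant comes down to `1 + ε`:

* `edgeNonnegOdd_flat_ineq` — for consecutive primes `q < q′` with `q ≥ 10⁷`, `0 < η ≤ 1/(4q)` and every order `k`:
  `EdgeNonnegOdd q q′ η → √q·r·M_k² ≤ 2·(log(1/r) + flatEnergyConst k + 6.1)`, `r = (log q′ − log q)/4` (PROVED) —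
  the flat lobe filling the window is otherwise a witness for `not_edgeNonnegOdd_of_witness`.
* `gap_le_of_edgeNonnegOdd_sharp` — for `0 < ε ≤ 1`, `ε(k+2) ≥ 8`, `q ≥ e⁸⁰` and `6(flatEnergyConst k + 9) ≤ ε·log q`:
  `EdgeNonnegOdd q q′ η → q′ − q ≤ (1 + ε)·√q·log q` (PROVED; the threshold is explicit modulo the unevaluated
  log-moment `L_k` inside `flatEnergyConst k`).
* `exists_gap_le_of_edgeNonnegOdd_sharp` — `∀ ε > 0 ∃ q₀ ∀ q ≥ q₀: EdgeNonnegOdd q q′ η → q′ − q ≤ (1+ε)√q log q` (PROVED).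
* `edgeNonnegOdd_sharp_classification` — **`∀ ε > 0 ∃ q₀ ∀ consecutive primes q ≥ q₀ ∀ η ∈ (0, 1/(4q)]:
  (q′ − q ≤ (1−ε)√q log q → EdgeNonnegOdd q q′ η) ∧ (EdgeNonnegOdd q q′ η → q′ − q ≤ (1+ε)√q log q)`** (PROVED);
  `edgeNonneg_sharp_classification` — the same with the FULL edge block `EdgeNonneg` in both slots (PROVED; no Dusart-type input).

So the asymptotic threshold constant of the edge block is EXACTLY `1` (ATTEMPT-7 §3 had `g_suff → 1⁻` and
`g* → 1/m² → 1⁺` as DERIVED numerics). An RH-free proof of «the edge block for all large q» is therefore the same thing as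
an RH-free proof of `p_{n+1} − p_n ≤ (1 + o(1))√p_n log p_n`: weaker in the constant than the RH-conditional `22/25` of
Carneiro–Milinovich–Soundararajan 2019 (so RH gives it, as it must, since RH gives `H(q)`), but UNCONDITIONAL — and
unconditionally open (Baker–Harman–Pintz: `p^{0.525}`; Cramér's conjecture would give `O(log² p)`).
-/

set_option linter.dupNamespace false

noncomputable section

open Complex Filter Set MeasureTheory Literature.NumberTheory.LFunctions
open scoped Real Topology ComplexConjugate ContDiff

namespace Summit.RiemannHypothesis.RiemannHypothesis.Theorems.Handoff

variable {q q' : ℕ}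

/-! ## §1 The per-window inequality forced by the odd edge block on a flat lobe -/

/-- **The flat-lobe inequality.** For consecutive primes `q < q′` with `q ≥ 10⁷`, an overlap `0 < η ≤ 1/(4q)` and any
order `k`: if `EdgeNonnegOdd q q′ η` then `√q·r·M_k² ≤ 2(log(1/r) + flatEnergyConst k + 6.1)` with `r = (log q′ − log q)/4`.
Otherwise the flat lobe `ψ_k((· − x₀)/r)`, `x₀ = (log q)/2 + r`, filling `[(log q)/2, (log q′)/2]` is a witness for
`not_edgeNonnegOdd_of_witness`: its polar mass is `|f̂(1)|² ≥ √q·r²·M_k²`, its energy `≤ (log(1/r) + flatEnergyConst k)·rN_k`,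
the even cross constant `≤ 6.1`, and `N_k ≤ 2`. [this track, ATTEMPT-9 §3] -/
theorem edgeNonnegOdd_flat_ineq (k : ℕ) (hcons : ConsecutivePrimes q q') (hq : (10 : ℝ) ^ 7 ≤ q) {η : ℝ}
    (hη : 0 < η) (hηq : η ≤ 1 / (4 * q)) (hE : EdgeNonnegOdd q q' η) :
    Real.sqrt q * ((Real.log q' - Real.log q) / 4) * flatMass k ^ 2 ≤
      2 * (Real.log (1 / ((Real.log q' - Real.log q) / 4)) + flatEnergyConst k + 6.1) := by
  have hq0 : (0 : ℝ) < q := by exact_mod_cast hcons.1.pos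
  have hqq' : (q : ℝ) < q' := by exact_mod_cast hcons.2.2.1
  have hq'0 : (0 : ℝ) < q' := hq0.trans hqq'
  have h2q : (q' : ℝ) ≤ 2 * q := by exact_mod_cast hcons.le_two_mul
  set r : ℝ := (Real.log q' - Real.log q) / 4 with hr_def
  have hr : 0 < r := by
    rw [hr_def]; linarith [Real.log_lt_log hq0 hqq']
  have hl2 := Real.log_two_lt_d9
  have hr4 : r ≤ 1 / 4 := by
    have := Real.log_le_log hq'0 h2q
    rw [Real.log_mul (by norm_num) hq0.ne'] at this
    rw [hr_def]; linarith
  set x₀ : ℝ := Real.log q / 2 + r with hx₀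
  set b : ℝ := Real.log q' / 2 with hb_def
  have hb : b ∈ Icc (Real.log q / 2) (Real.log q' / 2) :=
    ⟨by rw [hb_def]; linarith [Real.log_lt_log hq0 hqq'], le_rfl⟩
  set f := flatLobe k r x₀ with hf_def
  have hf : IsWeilTest f := isWeilTest_flatLobe hr x₀
  have hfs : tsupport f ⊆ Icc (Real.log q / 2) b := by
    refine (tsupport_flatLobe_subset hr x₀).trans (Icc_subset_Icc (by rw [hx₀]; linarith) ?_)
    rw [hx₀, hb_def, hr_def]; linarith
  have hη' : η < Real.log q / 2 := by
    have h16 : Real.exp 16 ≤ q := exp_sixteen_le.trans hq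
    have hlog16 : (16 : ℝ) ≤ Real.log q := by rw [Real.le_log_iff_exp_le hq0]; exact h16
    have : (1 : ℝ) / (4 * q) ≤ 1 := by rw [div_le_iff₀ (by positivity)]; linarith
    linarith [hηq.trans this]
  -- the three estimates
  have hE_le := re_weilQuadratic_flatLobe_le (k := k) hr hr4 x₀
  have hP_ge := normSq_weilMellin_flatLobe_one_ge (k := k) hr x₀
  have hX := handoffCrossConstEven_le_of_large hcons hq hη hηq hb
  have hN : ∫ x : ℝ, ‖f x‖ ^ 2 = r * weilNorm2Sq (flatProfile k) := integral_norm_sq_flatLobe hr x₀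
  set Φ := weilNorm2Sq (flatProfile k) with hΦ
  have hΦ2 : Φ ≤ 2 := weilNorm2Sq_flatProfile_le_two k
  have hΦ1 : 1 ≤ Φ := one_le_weilNorm2Sq_flatProfile k
  have hC6 := six_le_flatEnergyConst k
  have hexp : Real.exp (x₀ - r) = Real.sqrt q := by
    rw [hx₀, show Real.log q / 2 + r - r = Real.log q / 2 by ring,
      show Real.log q / 2 = Real.log q * (1 / 2) by ring, Real.exp_mul, Real.exp_log hq0, Real.sqrt_eq_rpow]
  have hlogr0 : 0 ≤ Real.log (1 / r) := Real.log_nonneg (by rw [le_div_iff₀ hr]; linarith)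
  -- EdgeNonnegOdd forbids the witness inequality
  have hnot : ¬ ((weilQuadratic f).re + handoffCrossConstEven q η b * ∫ u : ℝ, ‖f u‖ ^ 2 <
      Complex.normSq (weilMellin f 0) + Complex.normSq (weilMellin f 1)) :=
    fun hneg ↦ not_edgeNonnegOdd_of_witness hη hη' hb hf hfs hneg hE
  rw [not_lt, hN] at hnot
  rw [hN] at hE_le
  rw [hexp] at hP_ge
  have h0 : 0 ≤ Complex.normSq (weilMellin f 0) := Complex.normSq_nonneg _
  have hrΦ : 0 ≤ r * Φ := by positivity
  -- √q r² M² ≤ normSq f̂(1) ≤ (log(1/r) + C)·rΦ + 6.1·rΦ ≤ (log(1/r) + C + 6.1)·2r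
  have h1 : Real.sqrt q * r ^ 2 * flatMass k ^ 2 ≤ (Real.log (1 / r) + flatEnergyConst k + 6.1) * (r * Φ) := by
    have hX' := mul_le_mul_of_nonneg_right hX hrΦ
    nlinarith [hnot, hE_le, hP_ge, h0, hX']
  have h2 : (Real.log (1 / r) + flatEnergyConst k + 6.1) * (r * Φ) ≤
      (Real.log (1 / r) + flatEnergyConst k + 6.1) * (r * 2) := by
    refine mul_le_mul_of_nonneg_left (mul_le_mul_of_nonneg_left hΦ2 hr.le) ?_
    linarith
  have h3 : Real.sqrt q * r ^ 2 * flatMass k ^ 2 ≤ r * (2 * (Real.log (1 / r) + flatEnergyConst k + 6.1)) := by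
    linarith
  have h4 : Real.sqrt q * r ^ 2 * flatMass k ^ 2 = r * (Real.sqrt q * r * flatMass k ^ 2) := by ring
  rw [h4] at h3
  exact le_of_mul_le_mul_left h3 hr

/-! ## §2 The necessary Cramér constant is `1 + ε` -/

/-- **The odd edge block forces `q′ − q ≤ (1 + ε)·√q·log q`.** For `0 < ε ≤ 1`, an order `k` with `ε(k+2) ≥ 8`, consecutive
primes `q < q′` with `q ≥ e⁸⁰` and `6(flatEnergyConst k + 9) ≤ ε·log q`, and an overlap `0 < η ≤ 1/(4q)`:
`EdgeNonnegOdd q q′ η → q′ − q ≤ (1 + ε)√q·log q`. Proof: if the gap were larger, `r = ¼log(q′/q) ≥ (u₀/4)(1 − u₀)` with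
`u₀ = (1+ε)ℓ/√q ≤ ε/16` (`ℓ = log q`, `ℓ⁴ ≤ 384√q`), so `√q·r·M_k² ≥ (1+ε)(1 − u₀)(1 − ε/4)ℓ ≥ (1 + 3ε/8)ℓ`, while
`2(log(1/r) + C + 6.1) ≤ ℓ − 2 log ℓ + 2C + 16.2`; this contradicts `edgeNonnegOdd_flat_ineq` since `3εℓ/8 ≥ 2.25C + 20.25`.
[this track, ATTEMPT-9 §3] -/
theorem gap_le_of_edgeNonnegOdd_sharp {ε : ℝ} (hε : 0 < ε) (hε1 : ε ≤ 1) {k : ℕ} (hk : 8 ≤ ε * ((k : ℝ) + 2))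
    (hcons : ConsecutivePrimes q q') (hq : Real.exp 80 ≤ q)
    (hbig : 6 * (flatEnergyConst k + 9) ≤ ε * Real.log q) {η : ℝ} (hη : 0 < η) (hηq : η ≤ 1 / (4 * q))
    (hE : EdgeNonnegOdd q q' η) :
    (q' : ℝ) - q ≤ (1 + ε) * Real.sqrt q * Real.log q := by
  by_contra hgap
  rw [not_le] at hgap
  have hq0 : (0 : ℝ) < q := by exact_mod_cast hcons.1.pos
  have hqq' : (q : ℝ) < q' := by exact_mod_cast hcons.2.2.1
  have hq'0 : (0 : ℝ) < q' := hq0.trans hqq'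
  have h7 : (10 : ℝ) ^ 7 ≤ q :=
    ten_pow_seven_le_exp_seventeen.trans ((Real.exp_le_exp.2 (by norm_num)).trans hq)
  have h16 : Real.exp 16 ≤ q := (Real.exp_le_exp.2 (by norm_num)).trans hq
  have hq1 : (1 : ℝ) ≤ q := by linarith [Real.one_le_exp (by norm_num : (0:ℝ) ≤ 16), h16]
  set ℓ : ℝ := Real.log q with hℓ
  have hℓ80 : 80 ≤ ℓ := by rw [hℓ, Real.le_log_iff_exp_le hq0]; exact hq
  have hℓ0 : 0 < ℓ := by linarith
  have hsq : 0 < Real.sqrt q := Real.sqrt_pos.2 hq0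
  have hsqsq : Real.sqrt q * Real.sqrt q = q := Real.mul_self_sqrt hq0.le
  have hC6 := six_le_flatEnergyConst k
  set C := flatEnergyConst k with hC
  -- the flat-lobe inequality
  have hineq := edgeNonnegOdd_flat_ineq k hcons h7 hη hηq hE
  set r : ℝ := (Real.log q' - ℓ) / 4 with hr_def
  -- u₀ and its size
  set u₀ : ℝ := (1 + ε) * ℓ / Real.sqrt q with hu₀
  have hu₀pos : 0 < u₀ := by positivity
  have hℓ4 : ℓ ^ 4 ≤ 384 * Real.sqrt q := log_pow_four_le_sqrt hq1
  have h6400 : (6400 : ℝ) ≤ ℓ ^ 2 := by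
    have := pow_le_pow_left₀ (by norm_num) hℓ80 2
    linarith [this]
  have hεℓ : 90 ≤ ε * ℓ := by linarith [hbig, hC6]
  have hεℓ1 : ε * ℓ ≤ 1 * ℓ := mul_le_mul_of_nonneg_right hε1 hℓ0.le
  have hu₀small : u₀ ≤ ε / 16 := by
    rw [hu₀, div_le_iff₀ hsq]
    -- (1+ε)ℓ ≤ 2ℓ and 32ℓ ≤ ε√q, since ε ℓ⁴ ≥ 90·6400·ℓ ≥ 32·384·ℓ and ℓ⁴ ≤ 384 √q
    have hA : 90 * 6400 ≤ ε * ℓ * ℓ ^ 2 := mul_le_mul hεℓ h6400 (by norm_num) (by positivity)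
    have hB : 32 * 384 * ℓ ≤ ε * ℓ ^ 4 := by
      have e : ε * ℓ ^ 4 = ε * ℓ * ℓ ^ 2 * ℓ := by ring
      have hA' := mul_le_mul_of_nonneg_right hA hℓ0.le
      rw [e]; linarith [hA']
    have hC' : ε * ℓ ^ 4 ≤ ε * (384 * Real.sqrt q) := mul_le_mul_of_nonneg_left hℓ4 hε.le
    linarith [hεℓ1, hB, hC']
  have hu₀1 : u₀ ≤ 1 / 16 := hu₀small.trans (by linarith)
  have h1u₀ : 0 < 1 - u₀ := by linarith
  -- q′/q > 1 + u₀
  have hratio : 1 + u₀ < (q' : ℝ) / q := by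
    rw [lt_div_iff₀ hq0, hu₀]
    have e : (1 + ε) * ℓ / Real.sqrt q * (Real.sqrt q * Real.sqrt q) = (1 + ε) * Real.sqrt q * ℓ := by
      field_simp
    rw [hsqsq] at e
    rw [add_mul, one_mul, e]
    linarith
  -- r ≥ (u₀/4)(1 − u₀)
  have hr_ge : u₀ / 4 * (1 - u₀) ≤ r := by
    have h1 : 1 - (1 + u₀)⁻¹ ≤ Real.log (1 + u₀) := Real.one_sub_inv_le_log_of_pos (by linarith)
    have h2 : Real.log (1 + u₀) ≤ Real.log ((q' : ℝ) / q) := Real.log_le_log (by linarith) hratio.le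
    have h3 : Real.log ((q' : ℝ) / q) = Real.log q' - ℓ := by rw [hℓ, Real.log_div hq'0.ne' hq0.ne']
    have hinv : (1 + u₀)⁻¹ ≤ 1 - u₀ + u₀ ^ 2 := by
      rw [inv_eq_one_div, div_le_iff₀ (by linarith)]
      have e : (1 - u₀ + u₀ ^ 2) * (1 + u₀) = 1 + u₀ ^ 3 := by ring
      rw [e]
      linarith [pow_nonneg hu₀pos.le 3]
    have h4 : u₀ * (1 - u₀) ≤ 1 - (1 + u₀)⁻¹ := by linarith [hinv]
    rw [hr_def]
    linarith [h1, h2, h3, h4]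
  have hr_pos : 0 < r := lt_of_lt_of_le (by positivity) hr_ge
  -- log(1/r) ≤ ℓ/2 − log ℓ + 2
  have hlogr : Real.log (1 / r) ≤ ℓ / 2 - Real.log ℓ + 2 := by
    have h1 : 1 / r ≤ 1 / (u₀ / 4 * (1 - u₀)) := one_div_le_one_div_of_le (by positivity) hr_ge
    have h2 : 1 / (u₀ / 4 * (1 - u₀)) ≤ 5 / u₀ := by
      rw [div_le_div_iff₀ (by positivity) hu₀pos]
      have hp : u₀ * u₀ ≤ u₀ * (1 / 16) := mul_le_mul_of_nonneg_left hu₀1 hu₀pos.le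
      nlinarith only [hp, hu₀pos]
    have h3 : 5 / u₀ ≤ 5 * Real.sqrt q / ℓ := by
      have e : 5 / u₀ = 5 * Real.sqrt q / ((1 + ε) * ℓ) := by rw [hu₀]; field_simp
      rw [e]
      exact div_le_div_of_nonneg_left (by positivity) hℓ0 (by nlinarith only [hε, hℓ0])
    have h4 : 1 / r ≤ 5 * Real.sqrt q / ℓ := h1.trans (h2.trans h3)
    have h5 := Real.log_le_log (by positivity) h4
    rw [Real.log_div (by positivity) hℓ0.ne', Real.log_mul (by norm_num) hsq.ne', Real.log_sqrt hq0.le, ← hℓ] at h5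
    have h6 : Real.log 5 ≤ 2 := by
      have h7 : (5 : ℝ) ≤ Real.exp 2 := by linarith [exp_two_ge]
      have := Real.log_le_log (by norm_num) h7
      rwa [Real.log_exp] at this
    linarith
  -- M_k² ≥ 4(1 − ε/4)
  have hrIn : 1 - ε / 8 ≤ (flatBump k).rIn := by
    rw [flatBump_rIn]
    have hk2 : 0 < (k : ℝ) + 2 := by positivity
    have : 1 / ((k : ℝ) + 2) ≤ ε / 8 := by
      rw [div_le_div_iff₀ hk2 (by norm_num)]; linarith
    linarith
  have hM' : 4 * (1 - ε / 4) ≤ flatMass k ^ 2 := by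
    have h := two_mul_rIn_le_flatMass k
    have h1 : 2 - ε / 4 ≤ flatMass k := by linarith
    have h2 : (2 - ε / 4) ^ 2 ≤ flatMass k ^ 2 := pow_le_pow_left₀ (by linarith) h1 2
    nlinarith only [h2, sq_nonneg ε]
  have hlogℓ : 0 ≤ Real.log ℓ := Real.log_nonneg (by linarith)
  -- LHS ≥ (1 + 3ε/8) ℓ
  have hL : (1 + 3 * ε / 8) * ℓ ≤ Real.sqrt q * r * flatMass k ^ 2 := by
    have e1 : Real.sqrt q * (u₀ / 4 * (1 - u₀)) = (1 + ε) * ℓ / 4 * (1 - u₀) := by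
      rw [hu₀]; field_simp
    have h2 : (1 + ε) * ℓ / 4 * (1 - u₀) ≤ Real.sqrt q * r := by
      rw [← e1]; exact mul_le_mul_of_nonneg_left hr_ge hsq.le
    have h3 : 0 ≤ (1 + ε) * ℓ / 4 * (1 - u₀) := by positivity
    have h4 : (1 + ε) * ℓ / 4 * (1 - u₀) * (4 * (1 - ε / 4)) ≤ Real.sqrt q * r * flatMass k ^ 2 :=
      mul_le_mul h2 hM' (by linarith) (by positivity)
    have s1 : 1 + ε / 2 ≤ (1 + ε) * (1 - ε / 4) := by nlinarith only [mul_nonneg hε.le (sub_nonneg.2 hε1)]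
    have s2 : (1 + ε / 2) * (1 - u₀) ≤ (1 + ε) * (1 - ε / 4) * (1 - u₀) :=
      mul_le_mul_of_nonneg_right s1 h1u₀.le
    have s3 : (1 + ε / 2) * (1 - ε / 16) ≤ (1 + ε / 2) * (1 - u₀) :=
      mul_le_mul_of_nonneg_left (by linarith) (by positivity)
    have s4 : 1 + 3 * ε / 8 ≤ (1 + ε / 2) * (1 - ε / 16) := by
      nlinarith only [mul_nonneg hε.le (by linarith only [hε1] : (0:ℝ) ≤ 2 - ε)]
    have s5 : 1 + 3 * ε / 8 ≤ (1 + ε) * (1 - ε / 4) * (1 - u₀) := by linarith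
    have h6 : (1 + 3 * ε / 8) * ℓ ≤ (1 + ε) * (1 - ε / 4) * (1 - u₀) * ℓ := mul_le_mul_of_nonneg_right s5 hℓ0.le
    have h7 : (1 + ε) * (1 - ε / 4) * (1 - u₀) * ℓ = (1 + ε) * ℓ / 4 * (1 - u₀) * (4 * (1 - ε / 4)) := by ring
    linarith
  have hR : 2 * (Real.log (1 / r) + C + 6.1) ≤ ℓ - 2 * Real.log ℓ + 2 * C + 16.2 := by linarith
  have hfin : (1 + 3 * ε / 8) * ℓ ≤ ℓ - 2 * Real.log ℓ + 2 * C + 16.2 := hL.trans (hineq.trans hR)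
  have e : (1 + 3 * ε / 8) * ℓ = ℓ + 3 / 8 * (ε * ℓ) := by ring
  rw [e] at hfin
  linarith [hfin, hbig, hlogℓ, hC6]

/-- **For every `ε > 0`, the odd edge block at all large `q` forces `q′ − q ≤ (1 + ε)·√q·log q`.** [this track, ATTEMPT-9 §3] -/
theorem exists_gap_le_of_edgeNonnegOdd_sharp {ε : ℝ} (hε : 0 < ε) :
    ∃ q₀ : ℝ, ∀ q q' : ℕ, ConsecutivePrimes q q' → q₀ ≤ q → ∀ η : ℝ, 0 < η → η ≤ 1 / (4 * q) →
      EdgeNonnegOdd q q' η → (q' : ℝ) - q ≤ (1 + ε) * Real.sqrt q * Real.log q := by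
  set ε' : ℝ := min ε 1 with hε'
  have hε'0 : 0 < ε' := lt_min hε one_pos
  have hε'1 : ε' ≤ 1 := min_le_right _ _
  have hε'ε : ε' ≤ ε := min_le_left _ _
  set k : ℕ := ⌈8 / ε'⌉₊ with hk
  have hk8 : 8 ≤ ε' * ((k : ℝ) + 2) := by
    have h1 : 8 / ε' ≤ (k : ℝ) := Nat.le_ceil _
    have h2 : 8 ≤ (k : ℝ) * ε' := by rwa [div_le_iff₀ hε'0] at h1
    nlinarith [h2, hε'0.le]
  refine ⟨max (Real.exp 80) (Real.exp (6 * (flatEnergyConst k + 9) / ε')), fun q q' hcons hq η hη hηq hE ↦ ?_⟩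
  have hq0 : (0 : ℝ) < q := by exact_mod_cast hcons.1.pos
  have hq80 : Real.exp 80 ≤ q := (le_max_left _ _).trans hq
  have hbig : 6 * (flatEnergyConst k + 9) ≤ ε' * Real.log q := by
    have h1 : Real.exp (6 * (flatEnergyConst k + 9) / ε') ≤ q := (le_max_right _ _).trans hq
    rw [← Real.le_log_iff_exp_le hq0, div_le_iff₀ hε'0] at h1
    linarith
  have h := gap_le_of_edgeNonnegOdd_sharp hε'0 hε'1 hk8 hcons hq80 hbig hη hηq hE
  have hmono : (1 + ε') * Real.sqrt q * Real.log q ≤ (1 + ε) * Real.sqrt q * Real.log q := by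
    have hl : 0 ≤ Real.log q := Real.log_nonneg (by exact_mod_cast hcons.1.pos)
    have h0 : 0 ≤ Real.sqrt q * Real.log q := mul_nonneg (Real.sqrt_nonneg _) hl
    have h1 := mul_le_mul_of_nonneg_right (by linarith : 1 + ε' ≤ 1 + ε) h0
    have e1 : (1 + ε') * Real.sqrt q * Real.log q = (1 + ε') * (Real.sqrt q * Real.log q) := by ring
    have e2 : (1 + ε) * Real.sqrt q * Real.log q = (1 + ε) * (Real.sqrt q * Real.log q) := by ring
    rw [e1, e2]; exact h1
  exact h.trans hmono

/-! ## §3 The sharp classification -/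

/-- **The sharp two-sided classification of the odd edge block.** For every `ε > 0` there is `q₀` such that for all
consecutive primes `q < q′` with `q ≥ q₀` and all overlaps `0 < η ≤ 1/(4q)`:
`q′ − q ≤ (1 − ε)·√q·log q ⟹ EdgeNonnegOdd q q′ η` and `EdgeNonnegOdd q q′ η ⟹ q′ − q ≤ (1 + ε)·√q·log q`.
The asymptotic threshold constant of the odd edge block is therefore exactly `1`: «the odd edge block for all large q» and
«`p_{n+1} − p_n ≤ (1 + o(1))√p_n log p_n`» imply each other up to the `o(1)`. Both are open unconditionally; nothing here
bears on RH. [this track, ATTEMPT-8, ATTEMPT-9] -/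
theorem edgeNonnegOdd_sharp_classification {ε : ℝ} (hε : 0 < ε) :
    ∃ q₀ : ℝ, ∀ q q' : ℕ, ConsecutivePrimes q q' → q₀ ≤ q → ∀ η : ℝ, 0 < η → η ≤ 1 / (4 * q) →
      (((q' : ℝ) - q ≤ (1 - ε) * Real.sqrt q * Real.log q → EdgeNonnegOdd q q' η) ∧
        (EdgeNonnegOdd q q' η → (q' : ℝ) - q ≤ (1 + ε) * Real.sqrt q * Real.log q)) := by
  obtain ⟨q₁, hq₁⟩ := exists_gap_le_of_edgeNonnegOdd_sharp hε
  refine ⟨max q₁ (Real.exp (144 / (1 - (1 - ε)) ^ 2)), fun q q' hcons hq η hη hηq ↦ ⟨fun hgap ↦ ?_, ?_⟩⟩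
  · have hc : 1 - ε < 1 := by linarith
    have hq' : Real.exp (144 / (1 - (1 - ε)) ^ 2) ≤ q := (le_max_right _ _).trans hq
    exact ((edgeNonneg_iff_even_and_odd q q' η).1
      (edgeNonneg_of_gap_le_of_exp_le hcons hc hq' hgap hη hηq)).2
  · exact hq₁ q q' hcons ((le_max_left _ _).trans hq) η hη hηq

/-- **The same sharp classification for the FULL edge block** (both parities, no Dusart-type input): for every `ε > 0` there is `q₀`
such that for all consecutive primes `q ≥ q₀` and all overlaps `0 < η ≤ 1/(4q)`:
`q′ − q ≤ (1 − ε)·√q·log q ⟹ EdgeNonneg q q′ η` and `EdgeNonneg q q′ η ⟹ q′ − q ≤ (1 + ε)·√q·log q` — the (⇐) side of ATTEMPT-8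
delivers both parities, and the (⇒) side only needs the odd half. So the whole RH-free conjunct of the Schur split of the handoff increment
(`handoffH_iff_edgeNonneg_and_coupling`) is, for large `q`, EXACTLY the statement `q⁺ − q ≤ (1 + o(1))√q log q`. Nothing here bears on RH.
[this track, ATTEMPT-8, ATTEMPT-9] -/
theorem edgeNonneg_sharp_classification {ε : ℝ} (hε : 0 < ε) :
    ∃ q₀ : ℝ, ∀ q q' : ℕ, ConsecutivePrimes q q' → q₀ ≤ q → ∀ η : ℝ, 0 < η → η ≤ 1 / (4 * q) →
      (((q' : ℝ) - q ≤ (1 - ε) * Real.sqrt q * Real.log q → EdgeNonneg q q' η) ∧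
        (EdgeNonneg q q' η → (q' : ℝ) - q ≤ (1 + ε) * Real.sqrt q * Real.log q)) := by
  obtain ⟨q₁, hq₁⟩ := exists_gap_le_of_edgeNonnegOdd_sharp hε
  refine ⟨max q₁ (Real.exp (144 / (1 - (1 - ε)) ^ 2)), fun q q' hcons hq η hη hηq ↦ ⟨fun hgap ↦ ?_, fun hE ↦ ?_⟩⟩
  · have hc : 1 - ε < 1 := by linarith
    exact edgeNonneg_of_gap_le_of_exp_le hcons hc ((le_max_right _ _).trans hq) hgap hη hηq
  · exact hq₁ q q' hcons ((le_max_left _ _).trans hq) η hη hηq ((edgeNonneg_iff_even_and_odd q q' η).1 hE).2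

end Summit.RiemannHypothesis.RiemannHypothesis.Theorems.Handoff
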